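import Summits.MatrixMultiplication.OmegaCensus.SmallFormats.MatMul229GF3CoverTables
import Summits.MatrixMultiplication.OmegaCensus.SmallFormats.MatMul22nBoxCoverCertificate
import Summits.MatrixMultiplication.OmegaCensus.SmallFormats.MatMul227GF3EnumWLOG
import Summits.MatrixMultiplication.OmegaCensus.SmallFormats.MatMul229GF3Funnel
import HarnessLib

/-!
# ω-census family (a): the `(9,30)` cover certificate over `𝔽₃` — specification, WLOG reductions, and the cover theorem

Cell `pub-omega` (unit `pub-omega-tensor`, gen 41), topic `Summits/MatrixMultiplication/OmegaCensus` (sub-folder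
`SmallFormats`). Framing (verbatim): lottery ticket; floor = certified bounds/negative ranges. HONEST FRAMING: bookkeeping — the glue
between the count-vector clauses of the LOADED branch of the `(9,30)` funnel (`Enum723.funnel_930`, p729529) and the kernel replays of the
branch-and-bound certificate (`Cover930.runN`, `runK*`, `runG`, `runT`, `runD`, sibling files): given those replays, every admissible count
vector of the loaded branch is a group image — by a word in the five generators of `MatMul227GF3EnumSymmetry` — of `cnt M1` or `cnt M2`
(`Cover930.cover930_of_covers`, sibling file `MatMul229GF3CoverCases`). This file: the system and WLOG 1. Nothing here is a bound on any rank;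
nothing on `ω`.

* `Cover930.Adm930` — the loaded-branch clause system at `(9,30)`: J/`𝔽₉` loads `≤ 3`, row/column loads `≤ 4`, invertible lines
  `≤ 10`, digits `≤ 3`, total `30`, `σ ≥ 14`; invariant under the generators (`adm930_actWS`).
* WLOG 1 (`exists_sorted`): the row-plane loads and the column-plane loads can be sorted by words (`wRowL`, `wColL`, table facts by
  `decide`); then either load `35 ≤ 3` (case `N`, system `rowsN`) or all eight plane loads are `4` (`all4_of_sorted`).
* WLOG 2 (all-4): translate a present invertible class to class `0` (`wTransL`), then conjugate a present 4-cycle / 3-cycle /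
  transposition class to class `1` / `5` / `4` (`wKapC`, `wGamC`, `wTauC` of `MatMul227GF3EnumWLOG`): cases `κ`, `γ`, `τ`, `δ` (system
  `rowsA`, boxes `loK`, `loG/hiG`, `loT/hiT`, `hiD`) — in the sibling file.
The case systems, WLOG 2 and the cover theorem itself are in the sibling file `MatMul229GF3CoverCases`.
-/

namespace Summit.MatrixMultiplication.OmegaCensus.SmallFormats.Cover930

open Finset Enum723 BoxCover

set_option maxRecDepth 4000

/-! ## The clause system of the loaded branch -/

/-- Caps at `(9,30)`: J-planes and `𝔽₉`-planes `3`, row/column planes `4`, invertible lines `10` (as a function of the `(7,23)` cap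
table, so that the clause symmetries transfer). -/
def cap930 (k : ℕ) : ℕ := if cap k = 4 then 4 else if cap k = 9 then 10 else 3

/-- The caps by block. -/
theorem cap930_eq : ∀ k, k < 82 → cap930 k = if k < 32 then 3 else if k < 40 then 4 else if k < 58 then 3 else 10 := by decide

/-- **Admissible count vectors of the loaded branch at `(9,30)`.** -/
def Adm930 (c : ℕ → ℕ) : Prop :=
  (∀ k, k < 82 → load c k ≤ cap930 k) ∧ (∀ a, a < 40 → c a ≤ 3) ∧ tot c = 30 ∧ 14 ≤ acnt c

/-- All eight plane loads equal `4`. -/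
def All4 (c : ℕ → ℕ) : Prop := ∀ k, 32 ≤ k → k < 40 → load c k = 4

/-- Row-plane loads and column-plane loads sorted (non-increasing). -/
def SortedRC (c : ℕ → ℕ) : Prop :=
  load c 33 ≤ load c 32 ∧ load c 34 ≤ load c 33 ∧ load c 35 ≤ load c 34 ∧
    load c 37 ≤ load c 36 ∧ load c 38 ≤ load c 37 ∧ load c 39 ≤ load c 38

/-! ### Invariance under the generators -/

/-- The generators preserve the rank-one classes `24–39`. -/
theorem gsrc_rk1 : ∀ s, s < 5 → ∀ b, b < 40 → (24 ≤ gsrc s b ↔ 24 ≤ b) ∧ (24 ≤ gfwd s b ↔ 24 ≤ b) := by decide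

/-- The generators permute the plane clauses `32–39` among themselves. -/
theorem kinv_plane : ∀ s, s < 5 → ∀ k, 32 ≤ k → k < 40 → 32 ≤ kinv s k ∧ kinv s k < 40 := by decide

/-- Loads transform by the inverse clause permutation. -/
theorem load_actS (s : ℕ) (hs : s < 5) (c : ℕ → ℕ) (k : ℕ) (hk : k < 82) : load (actS s c) k = load c (kinv s k) := by
  obtain ⟨-, -, hinc⟩ := gen_clause s hs k hk
  simp only [load, actS]
  rw [sum_reindex s hs c (fun b => inc b k)]
  exact Finset.sum_congr rfl fun a ha => by rw [hinc a (Finset.mem_range.mp ha)]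

/-- The total is invariant. -/
theorem tot_actS (s : ℕ) (hs : s < 5) (c : ℕ → ℕ) : tot (actS s c) = tot c := by
  have := sum_reindex s hs c (fun _ => 1)
  simp only [mul_one] at this
  simp only [tot, actS]; rw [this]

/-- The number of rank-one terms is invariant. -/
theorem acnt_actS (s : ℕ) (hs : s < 5) (c : ℕ → ℕ) : acnt (actS s c) = acnt c := by
  have hp := (gen_perm s hs).2.2
  have hr := gsrc_rk1 s hs
  simp only [acnt, actS]
  refine Finset.sum_nbij' (gsrc s) (gfwd s) (fun b hb => ?_) (fun a ha => ?_) (fun b hb => ?_) (fun a ha => ?_) (fun b hb => ?_)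
  · have hb' := Finset.mem_Ico.mp hb
    exact Finset.mem_Ico.mpr ⟨((hr b hb'.2).1).mpr hb'.1, (hp b hb'.2).1⟩
  · have ha' := Finset.mem_Ico.mp ha
    exact Finset.mem_Ico.mpr ⟨((hr a ha'.2).2).mpr ha'.1, (hp a ha'.2).2.1⟩
  · exact (hp b (Finset.mem_Ico.mp hb).2).2.2.1
  · exact (hp a (Finset.mem_Ico.mp ha).2).2.2.2.1
  · rfl

/-- A generator preserves admissibility. -/
theorem adm930_actS (s : ℕ) (hs : s < 5) {c : ℕ → ℕ} (h : Adm930 c) : Adm930 (actS s c) := by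
  obtain ⟨hcap, hdig, htot, hac⟩ := h
  refine ⟨fun k hk => ?_, fun b hb => hdig _ ((gen_perm s hs).2.2 b hb).1, by rw [tot_actS s hs]; exact htot,
    by rw [acnt_actS s hs]; exact hac⟩
  obtain ⟨hk', hcapk, -⟩ := gen_clause s hs k hk
  rw [load_actS s hs c k hk]
  have : cap930 (kinv s k) = cap930 k := by simp only [cap930, hcapk]
  rw [← this]; exact hcap _ hk'

/-- Words preserve admissibility. -/
theorem adm930_actWS (w : List ℕ) (hw : WordOK w) {c : ℕ → ℕ} (h : Adm930 c) : Adm930 (actWS w c) := by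
  induction w generalizing c with
  | nil => exact h
  | cons s w ih => exact ih (fun t ht => hw t (by simp [ht])) (adm930_actS s (hw s (by simp)) h)

/-- A generator preserves `All4`. -/
theorem all4_actS (s : ℕ) (hs : s < 5) {c : ℕ → ℕ} (h : All4 c) : All4 (actS s c) := fun k hk1 hk2 => by
  rw [load_actS s hs c k (by omega)]
  obtain ⟨h1, h2⟩ := kinv_plane s hs k hk1 hk2
  exact h _ h1 h2

/-- Words preserve `All4`. -/
theorem all4_actWS (w : List ℕ) (hw : WordOK w) {c : ℕ → ℕ} (h : All4 c) : All4 (actWS w c) := by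
  induction w generalizing c with
  | nil => exact h
  | cons s w ih => exact ih (fun t ht => hw t (by simp [ht])) (all4_actS s (hw s (by simp)) h)

/-- Clause map of a word: `load (actWS w c) k = load c (kinvW w k)`. -/
def kinvW : List ℕ → ℕ → ℕ
  | [], k => k
  | s :: w, k => kinv s (kinvW w k)

/-- The clause map of a word stays below `82`. -/
theorem kinvW_lt : ∀ (w : List ℕ), WordOK w → ∀ k, k < 82 → kinvW w k < 82
  | [], _, k, hk => hk
  | s :: w, hw, k, hk => by
      rw [kinvW]
      exact (gen_clause s (hw s (by simp)) _ (kinvW_lt w (fun t ht => hw t (by simp [ht])) k hk)).1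

/-- Loads along a word. -/
theorem load_actWS : ∀ (w : List ℕ), WordOK w → ∀ (c : ℕ → ℕ) (k : ℕ), k < 82 → load (actWS w c) k = load c (kinvW w k)
  | [], _, _, _, _ => rfl
  | s :: w, hw, c, k, hk => by
      have hs : s < 5 := hw s (by simp)
      have hw' : WordOK w := fun t ht => hw t (by simp [ht])
      rw [actWS, load_actWS w hw' (actS s c) k hk, kinvW, load_actS s hs c _ (kinvW_lt w hw' k hk)]

/-! ### WLOG 1: sorting the plane loads -/

/-- The row-permutation words: in the generators, row loads permuted as listed, column loads fixed. -/
theorem wRow_fact : ∀ i, i < 24 → WordOK (wRowL.getD i []) ∧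
    (∀ t, t < 4 → kinvW (wRowL.getD i []) (32 + t) = 32 + (perm4L.getD i []).getD t 0) ∧
    (∀ t, t < 4 → kinvW (wRowL.getD i []) (36 + t) = 36 + t) := by decide

/-- The column-permutation words: column loads permuted as listed, row loads fixed. -/
theorem wCol_fact : ∀ i, i < 24 → WordOK (wColL.getD i []) ∧
    (∀ t, t < 4 → kinvW (wColL.getD i []) (36 + t) = 36 + (perm4L.getD i []).getD t 0) ∧
    (∀ t, t < 4 → kinvW (wColL.getD i []) (32 + t) = 32 + t) := by decide

/-- The permutation table lists maps into `[0, 4)`. -/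
theorem perm4L_lt : ∀ i, i < 24 → ∀ t, t < 4 → (perm4L.getD i []).getD t 0 < 4 := by decide

/-- Four numbers `≤ 4` can be sorted by one of the 24 listed permutations. -/
theorem exists_sort4 : ∀ l0, l0 < 5 → ∀ l1, l1 < 5 → ∀ l2, l2 < 5 → ∀ l3, l3 < 5 → ∃ i, i < 24 ∧
    [l0, l1, l2, l3].getD ((perm4L.getD i []).getD 1 0) 0 ≤ [l0, l1, l2, l3].getD ((perm4L.getD i []).getD 0 0) 0 ∧
    [l0, l1, l2, l3].getD ((perm4L.getD i []).getD 2 0) 0 ≤ [l0, l1, l2, l3].getD ((perm4L.getD i []).getD 1 0) 0 ∧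
    [l0, l1, l2, l3].getD ((perm4L.getD i []).getD 3 0) 0 ≤ [l0, l1, l2, l3].getD ((perm4L.getD i []).getD 2 0) 0 := by
  decide

/-- Plane loads of an admissible vector are `≤ 4`. -/
theorem load_plane_le (c : ℕ → ℕ) (h : Adm930 c) (k : ℕ) (hk1 : 32 ≤ k) (hk2 : k < 40) : load c k ≤ 4 := by
  have := h.1 k (by omega)
  rw [cap930_eq k (by omega)] at this
  simp only [show ¬ k < 32 by omega, hk2, if_false, if_true] at this
  exact this

/-- A list lookup lemma for the sorting step. -/
private theorem getD_four (f : ℕ → ℕ) (j : ℕ) (hj : j < 4) : [f 0, f 1, f 2, f 3].getD j 0 = f j := by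
  interval_cases j <;> rfl

/-- Entry `t` of permutation `i`. -/
def P4 (i t : ℕ) : ℕ := (perm4L.getD i []).getD t 0

/-- Four values `≤ 4` of a function can be sorted by one of the 24 listed permutations. -/
theorem exists_sort4_fun (l : ℕ → ℕ) (hl : ∀ t, t < 4 → l t ≤ 4) :
    ∃ i, i < 24 ∧ l (P4 i 1) ≤ l (P4 i 0) ∧ l (P4 i 2) ≤ l (P4 i 1) ∧ l (P4 i 3) ≤ l (P4 i 2) := by
  obtain ⟨i, hi, s1, s2, s3⟩ := exists_sort4 (l 0) (by have := hl 0 (by norm_num); omega) (l 1)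
    (by have := hl 1 (by norm_num); omega) (l 2) (by have := hl 2 (by norm_num); omega) (l 3) (by have := hl 3 (by norm_num); omega)
  have hp := perm4L_lt i hi
  rw [getD_four l _ (hp 1 (by norm_num)), getD_four l _ (hp 0 (by norm_num))] at s1
  rw [getD_four l _ (hp 2 (by norm_num)), getD_four l _ (hp 1 (by norm_num))] at s2
  rw [getD_four l _ (hp 3 (by norm_num)), getD_four l _ (hp 2 (by norm_num))] at s3
  exact ⟨i, hi, s1, s2, s3⟩

/-- **WLOG 1**: the plane loads can be sorted by a word. -/
theorem exists_sorted (c : ℕ → ℕ) (h : Adm930 c) : ∃ w, WordOK w ∧ SortedRC (actWS w c) := by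
  -- rows
  obtain ⟨i, hi, s1, s2, s3⟩ := exists_sort4_fun (fun t => load c (32 + t))
    (fun t ht => load_plane_le c h (32 + t) (by omega) (by omega))
  obtain ⟨hw1, hrow1, hcol1⟩ := wRow_fact i hi
  set w1 := wRowL.getD i [] with hw1def
  set c1 := actWS w1 c with hc1
  have er : ∀ t, t < 4 → load c1 (32 + t) = load c (32 + P4 i t) := fun t ht => by
    rw [hc1, load_actWS w1 hw1 c _ (by omega), hrow1 t ht, P4]
  have ec : ∀ t, t < 4 → load c1 (36 + t) = load c (36 + t) := fun t ht => by
    rw [hc1, load_actWS w1 hw1 c _ (by omega), hcol1 t ht]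
  -- columns
  have h1 : Adm930 c1 := adm930_actWS w1 hw1 h
  obtain ⟨i', hi', t1, t2, t3⟩ := exists_sort4_fun (fun t => load c1 (36 + t))
    (fun t ht => load_plane_le c1 h1 (36 + t) (by omega) (by omega))
  obtain ⟨hw2, hcol2, hrow2⟩ := wCol_fact i' hi'
  set w2 := wColL.getD i' [] with hw2def
  refine ⟨w1 ++ w2, wordOK_append hw1 hw2, ?_⟩
  rw [actWS_append, ← hc1]
  have er' : ∀ t, t < 4 → load (actWS w2 c1) (32 + t) = load c (32 + P4 i t) := fun t ht => by
    rw [load_actWS w2 hw2 c1 _ (by omega), hrow2 t ht, er t ht]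
  have ec' : ∀ t, t < 4 → load (actWS w2 c1) (36 + t) = load c1 (36 + P4 i' t) := fun t ht => by
    rw [load_actWS w2 hw2 c1 _ (by omega), hcol2 t ht, P4]
  refine ⟨?_, ?_, ?_, ?_, ?_, ?_⟩
  · change load (actWS w2 c1) (32 + 1) ≤ load (actWS w2 c1) (32 + 0)
    rw [er' 1 (by norm_num), er' 0 (by norm_num)]; exact s1
  · change load (actWS w2 c1) (32 + 2) ≤ load (actWS w2 c1) (32 + 1)
    rw [er' 2 (by norm_num), er' 1 (by norm_num)]; exact s2
  · change load (actWS w2 c1) (32 + 3) ≤ load (actWS w2 c1) (32 + 2)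
    rw [er' 3 (by norm_num), er' 2 (by norm_num)]; exact s3
  · change load (actWS w2 c1) (36 + 1) ≤ load (actWS w2 c1) (36 + 0)
    rw [ec' 1 (by norm_num), ec' 0 (by norm_num)]; exact t1
  · change load (actWS w2 c1) (36 + 2) ≤ load (actWS w2 c1) (36 + 1)
    rw [ec' 2 (by norm_num), ec' 1 (by norm_num)]; exact t2
  · change load (actWS w2 c1) (36 + 3) ≤ load (actWS w2 c1) (36 + 2)
    rw [ec' 3 (by norm_num), ec' 2 (by norm_num)]; exact t3

/-- Row loads sum to `σ`, column loads sum to `σ` (from `MatMul229GF3Funnel`). -/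
theorem plane_sums (c : ℕ → ℕ) :
    load c 32 + load c 33 + load c 34 + load c 35 = acnt c ∧ load c 36 + load c 37 + load c 38 + load c 39 = acnt c := by
  have hrows := sum_load_rows_eq c
  have hcols := sum_load_cols_eq c
  rw [Finset.sum_Ico_succ_top (by norm_num), Finset.sum_Ico_succ_top (by norm_num), Finset.sum_Ico_succ_top (by norm_num),
    Finset.sum_Ico_succ_top (by norm_num), Finset.Ico_self, Finset.sum_empty] at hrows hcols
  simp only [zero_add] at hrows hcols
  exact ⟨hrows, hcols⟩

/-- In the sorted position: loads `32` and `36` are `4`. -/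
theorem load_32_36 (c : ℕ → ℕ) (h : Adm930 c) (hs : SortedRC c) : 4 ≤ load c 32 ∧ 4 ≤ load c 36 := by
  obtain ⟨hr, hc⟩ := plane_sums c
  obtain ⟨s1, s2, s3, t1, t2, t3⟩ := hs
  have := h.2.2.2
  have l32 := load_plane_le c h 32 (by norm_num) (by norm_num)
  have l36 := load_plane_le c h 36 (by norm_num) (by norm_num)
  constructor <;> omega

/-- In the sorted position: if load `35` is not `≤ 3` then all eight plane loads are `4`. -/
theorem all4_of_sorted (c : ℕ → ℕ) (h : Adm930 c) (hs : SortedRC c) (h35 : ¬ load c 35 ≤ 3) : All4 c := by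
  obtain ⟨hr, hc⟩ := plane_sums c
  obtain ⟨s1, s2, s3, t1, t2, t3⟩ := hs
  have l := fun k hk1 hk2 => load_plane_le c h k hk1 hk2
  have l32 := l 32 (by norm_num) (by norm_num); have l33 := l 33 (by norm_num) (by norm_num)
  have l34 := l 34 (by norm_num) (by norm_num); have l35 := l 35 (by norm_num) (by norm_num)
  have l36 := l 36 (by norm_num) (by norm_num); have l37 := l 37 (by norm_num) (by norm_num)
  have l38 := l 38 (by norm_num) (by norm_num); have l39 := l 39 (by norm_num) (by norm_num)
  intro k hk1 hk2
  interval_cases k <;> omega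

end Summit.MatrixMultiplication.OmegaCensus.SmallFormats.Cover930
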